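import Summits.QuantumFields.BalabanUV.Beta.D1BFx.ChartDefectRepair

/-!
# `BalabanUV.Beta.D1BFx.ChartDefectTransportDefect` — road «BF-x», binder row D1, PART 24-hyb (c2), PART 6 (an input to the row's RE-LEG ∕ RE-TABLE ruling):
# **THE CHART DEFECT OF A RE-TABLED ROAD IS THE ONE-LOOP WORD LIST OF THE TRANSPORT DEFECTS OF ITS TABLES.**

For ANY localised vertex families — the literal's `Vs, Ws` (read at the literal's kernel `GcombSh n 0 = Ψ̂∘G₀∘Ψ̂ᵀ`, `Ψ̂ = psiKS (ctrOff (d+1) n) n`,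
`SymCorrectorTransport.GcombSh_zero_eq_conj_psiKS_KInvStep`) and a road's OWN `Vc, Wc` (read at the road's kernel `G₀ = coDressKBmAt ρ_c n (KInvStep n 0)`):
`hessKer (GcombSh n 0) Vs Ws μνz − hessKer G₀ Vc Wc μνz = ½·tadpole G₀ (δW μ0νz) − ½·(bubble G₀ (Vc μ0) (δV νz) + bubble G₀ (δV μ0) (Vc νz)) − ½·bubble G₀ (δV μ0) (δV νz)`
with the TRANSPORT DEFECTS `δV := Ψ̂ᵀ∘Vs∘Ψ̂ − Vc`, `δW := Ψ̂ᵀ∘Ws∘Ψ̂ − Wc` (`HessKerConjugation.hessKer_conj_kernel` + `hessKer_add_add_sub`).  The hybrid road of record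
(J1-β) is the case `Vc := Vs` (`ChartDefectRepair.literal_sub_road_eq_conjDefect_words_level0`); a RE-TABLED road chooses `Vc, Wc` = its own scheme's tables, and
its chart defect is the word list of the defects — it VANISHES if its tables are the corrector-transport of the literal's.  Located, zero weight: nothing is priced; which tables a road carries is
the row's ruling, not this file's.

HONEST DEPENDENCY (cell records, verbatim): «continuum YM on T⁴ ⇐ BetaPertH ∧ nine spine estimates (0/9 proved); BetaPertH ⇐ (D1) ∧ (D4) ∧
CAP+tail; G-an2-4 gates asym, D1 and NE2/3/4.»  HONEST FRAMING (cell contract, verbatim): «discharging `BetaPertH` makes Bałaban's UV stability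
UNCONDITIONAL — a real constructive-QFT result; it is NOT the continuum limit and NOT the Clay problem.»  THIS MODULE DISCHARGES NOTHING of the wall:
[folklore] two instances BY NAME; no definition, no `def … : Prop`, nothing cited, 0 sorry, default heartbeats.  0∕4 row-D1 binders; (K) NOT closed;
(J1) ONE OPEN ROW; NOT D1, NEVER «G-an2-4 closed», NOT `BetaPertH`, NOT continuum, NOT Clay.

ABSOLUTE RULE (cell charter, verbatim): «No internally-minted statement may enter as a cited fact. Every hypothesis is either kernel-proved in this
package or a verbatim quotation of a PUBLISHED theorem with page reference. The manuscript(s) under audit are NOT citable for their own disputed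
steps — they are the thing under adjudication; programme-internal (2001/route/tribunal) claims are never citable.»

Unit `b2b-balaban-beta-d1-p2` (road owner, gen 27), 2026-08-24; no existing file touched.
-/

noncomputable section

namespace Summit.QuantumFields.BalabanUV.Beta.D1BFx.ChartDefectTransportDefect

open Literature.MathematicalPhysics.QuantumFieldTheory.Balaban1983to89
open Literature.MathematicalPhysics.QuantumFieldTheory.Balaban1983to89.Beta
open ExpKernelCalculus (MKer comp tadpole bubble hessKer)
open OneStepResolventKernel (Fib)
open OneStepKernelFamily (KInvStep)
open AffineAveraging (box)
open AveragingContoursRooted (ctr ctrOff ctrOff_mem_box)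
open Summit.QuantumFields.BalabanUV.Beta.TameKernelCalculus
open Summit.QuantumFields.BalabanUV.Beta.AxialDressingRooted (coDressKBmAt)
open Summit.QuantumFields.BalabanUV.Beta.CombChartStepJets (GcombSh)
open Summit.QuantumFields.BalabanUV.Beta.SymCorrectorKernel (psiKS spr_psiKS)
open Summit.QuantumFields.BalabanUV.Beta.SymCorrectorTransport (GcombSh_zero_eq_conj_psiKS_KInvStep)
open Summit.QuantumFields.BalabanUV.Beta.D1BFx.ChartDefectResolvent (spr_G0bm_ctr)
open Summit.QuantumFields.BalabanUV.Beta.D1BFx.HessKerConjugation (hessKer_conj_kernel hessKer_add_add_sub)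

variable {d : ℕ} (n : ℕ) [NeZero n]

/-- [folklore] **THE CHART DEFECT OF A RE-TABLED ROAD = THE ONE-LOOP WORDS OF THE TRANSPORT DEFECTS.**  `G₀ := coDressKBmAt ρ_c n (KInvStep n 0)`,
`Ψ̂ := psiKS (ctrOff (d+1) n) n`; literal families `Vs, Ws` and road families `Vc, Wc`, all localised; `δV := Ψ̂ᵀ∘Vs∘Ψ̂ − Vc`, `δW := Ψ̂ᵀ∘Ws∘Ψ̂ − Wc`:
`hessKer (GcombSh n 0) Vs Ws μνz − hessKer G₀ Vc Wc μνz = ½·tadpole G₀ (δW μ0νz) − ½·(bubble G₀ (Vc μ0) (δV νz) + bubble G₀ (δV μ0) (Vc νz)) − ½·bubble G₀ (δV μ0) (δV νz)`. -/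
theorem literal_sub_retabled_eq_transportDefect_words
    {Vs Vc : Fin (d + 1) → (Fin (d + 1) → ℤ) → MKer (d + 1) (Fib d)}
    {Ws Wc : Fin (d + 1) → (Fin (d + 1) → ℤ) → Fin (d + 1) → (Fin (d + 1) → ℤ) → MKer (d + 1) (Fib d)}
    (hVs : ∀ μ y, Loc (Vs μ y)) (hVc : ∀ μ y, Loc (Vc μ y)) (hWs : ∀ μ y ν y', Loc (Ws μ y ν y')) (hWc : ∀ μ y ν y', Loc (Wc μ y ν y'))
    (μ ν : Fin (d + 1)) (z : Fin (d + 1) → ℤ) :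
    hessKer (GcombSh (d := d) n 0) Vs Ws μ ν z - hessKer (coDressKBmAt (ctr (d + 1) n) n (KInvStep (d := d) n 0)) Vc Wc μ ν z
      = (1 / 2) * tadpole (coDressKBmAt (ctr (d + 1) n) n (KInvStep (d := d) n 0))
            (comp (comp (trK (psiKS (ctrOff (d + 1) n) n)) (Ws μ 0 ν z)) (psiKS (ctrOff (d + 1) n) n) - Wc μ 0 ν z)
        - (1 / 2) * (bubble (coDressKBmAt (ctr (d + 1) n) n (KInvStep (d := d) n 0)) (Vc μ 0)
                (comp (comp (trK (psiKS (ctrOff (d + 1) n) n)) (Vs ν z)) (psiKS (ctrOff (d + 1) n) n) - Vc ν z)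
            + bubble (coDressKBmAt (ctr (d + 1) n) n (KInvStep (d := d) n 0))
                (comp (comp (trK (psiKS (ctrOff (d + 1) n) n)) (Vs μ 0)) (psiKS (ctrOff (d + 1) n) n) - Vc μ 0) (Vc ν z))
        - (1 / 2) * bubble (coDressKBmAt (ctr (d + 1) n) n (KInvStep (d := d) n 0))
            (comp (comp (trK (psiKS (ctrOff (d + 1) n) n)) (Vs μ 0)) (psiKS (ctrOff (d + 1) n) n) - Vc μ 0)
            (comp (comp (trK (psiKS (ctrOff (d + 1) n) n)) (Vs ν z)) (psiKS (ctrOff (d + 1) n) n) - Vc ν z) := by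
  have hn : 0 < n := Nat.pos_of_ne_zero (NeZero.ne n)
  have hP : Spr (psiKS (ctrOff (d + 1) n) n) := spr_psiKS hn (ctrOff_mem_box hn)
  -- transported literal families and their defects against the road's own
  have hVt : ∀ μ' y, Loc (comp (comp (trK (psiKS (ctrOff (d + 1) n) n)) (Vs μ' y)) (psiKS (ctrOff (d + 1) n) n)) :=
    fun μ' y => (hP.trK.comp_loc (hVs μ' y)).comp_spr hP
  have hWt : ∀ μ' y ν' y', Loc (comp (comp (trK (psiKS (ctrOff (d + 1) n) n)) (Ws μ' y ν' y')) (psiKS (ctrOff (d + 1) n) n)) :=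
    fun μ' y ν' y' => (hP.trK.comp_loc (hWs μ' y ν' y')).comp_spr hP
  have hδV : ∀ μ' y, Loc (comp (comp (trK (psiKS (ctrOff (d + 1) n) n)) (Vs μ' y)) (psiKS (ctrOff (d + 1) n) n) - Vc μ' y) :=
    fun μ' y => (hVt μ' y).sub (hVc μ' y)
  have hδW : ∀ μ' y ν' y', Loc (comp (comp (trK (psiKS (ctrOff (d + 1) n) n)) (Ws μ' y ν' y')) (psiKS (ctrOff (d + 1) n) n) - Wc μ' y ν' y') :=
    fun μ' y ν' y' => (hWt μ' y ν' y').sub (hWc μ' y ν' y')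
  -- the transported families = road families + defects (pointwise)
  have eV : (fun μ' y => comp (comp (trK (psiKS (ctrOff (d + 1) n) n)) (Vs μ' y)) (psiKS (ctrOff (d + 1) n) n))
      = Vc + fun μ' y => comp (comp (trK (psiKS (ctrOff (d + 1) n) n)) (Vs μ' y)) (psiKS (ctrOff (d + 1) n) n) - Vc μ' y := by
    funext μ' y; simp only [Pi.add_apply, add_sub_cancel]
  have eW : (fun μ' y ν' y' => comp (comp (trK (psiKS (ctrOff (d + 1) n) n)) (Ws μ' y ν' y')) (psiKS (ctrOff (d + 1) n) n))
      = Wc + fun μ' y ν' y' => comp (comp (trK (psiKS (ctrOff (d + 1) n) n)) (Ws μ' y ν' y')) (psiKS (ctrOff (d + 1) n) n) - Wc μ' y ν' y' := by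
    funext μ' y ν' y'; simp only [Pi.add_apply, add_sub_cancel]
  rw [GcombSh_zero_eq_conj_psiKS_KInvStep n, hessKer_conj_kernel hP spr_G0bm_ctr hVs hWs μ ν z, eV, eW]
  exact hessKer_add_add_sub spr_G0bm_ctr hVc hδV hWc hδW μ ν z

end Summit.QuantumFields.BalabanUV.Beta.D1BFx.ChartDefectTransportDefect

end
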